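import Summits.BirchSwinnertonDyer.Rank1Residual.P2.CMRankOneAtTwoHeegnerIndex
import Literature.NumberTheory.EllipticCurves.BSDShaProofs
import HarnessLib

/-!
# Cell «bsd-cm», seat bsd-cm-two: the typed O12 input MOD 2 — the pre-registered parity law P1
# (`ord₂ 𝔮` is EVEN), a consequence of `BSD(E,2)` + Cassels–Tate, typed as a target of its own

HONEST FRAMING (cell «bsd-cm», `run/shared/lean/pub/bsd-cm/`, D-0033 tranche 1a; seat `bsd-cm-two`):
the O12 corner (CM, `r_an = 1`, `p = 2`; 16 cells) is OPEN; `P2/CMRankOneAtTwoHeegnerIndex.lean` typed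
its missing input as the `L`-free identity `ord₂ 𝔮 = ord₂ #Ш(E)` (`CMRankOneHeegnerIndexAtTwo`). Since
`#Ш(E)` is a SQUARE when finite (Cassels–Tate; tree named fact `exists_casselsTate_pairing` with the
proved consequence `isSquare_card_sha_of_finite_of_casselsTate`), the input implies the PARITY LAW
`ord₂ 𝔮 ≡ 0 (mod 2)` — the seat's pre-registered prediction P1 (memo `pub/bsd-cm/MEMO-bsd-cm-two.md` §3(b),
§8: verified 86/86 on 16 control pairs where `BSD(E,2)` is a theorem and 70 open pairs, PARI job j236394;
unwound at the primes of `K′` it reads `ord₂(#π₀(E(ℝ)) · ∏c_ℓ(E) · u · ∏c_ℓ(E^{(D)})) ≡ 1 (mod 2)` and is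
Kramer's 1981 parity theorem for `E/K′` in disguise — so P1 is EXPLAINED by print and is NOT evidence
for BSD). This file types P1 (`@[conjecture]`, nothing asserted — its derivation from Kramer 1981 Thm 1 +
Props 3–6 needs Kramer's Props 4–5 at a ramified `2`, not yet in the tree) and PROVES: (i) per pair,
`BSD(E,2) ⇒ ord₂ 𝔮` even; (ii) class-wide, `CMRankOneHeegnerIndexAtTwo ⇒ P1`. No arithmetic fact is
asserted; Cassels–Tate, Gross–Zagier, Kolyvagin, GZK, modularity, Burungale–Flach enter as binders.
§2 records an UNCONDITIONAL by-product: the `L`-free index quotient `𝔮` does not depend on the auxiliary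
datum (`cmHeegnerIndexQuotient_eq_of_two_data`) — Heegner indices over different fields `K₁, K₂` against
the Tate–Shafarevich groups of the corresponding rank-zero CM twists, with no `L`-value left.

References: [Cassels1962ArithmeticIV] / [MilneADT2006] I.6.13 (Cassels–Tate, through the tree's
`exists_casselsTate_pairing`); [Kramer1981] Thm. 1, Props 3, 6; [BurungaleFlach2024] Thm 1.1, Cor. 2;
[Miller2011LMS] Def. 1.1; parent `P2/CMRankOneAtTwoHeegnerIndex.lean` (p396383).
-/

noncomputable section

open scoped Classical

open WeierstrassCurve NumberField Literature.NumberTheory.EllipticCurves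
  Literature.NumberTheory.EllipticCurves.ModularForms
  Literature.NumberTheory.EllipticCurves.Rank1Residual
  Literature.NumberTheory.EllipticCurves.Rank1Residual.Typed

set_option autoImplicit false

namespace Summit.BirchSwinnertonDyer.Rank1Residual.P2

/-- The `2`-adic valuation of a square natural number is even. [folklore] -/
theorem even_padicValNat_two_of_isSquare {n : ℕ} (hn : n ≠ 0) (h : IsSquare n) :
    Even (padicValNat 2 n) := by
  obtain ⟨m, rfl⟩ := h
  have hm : m ≠ 0 := by rintro rfl; exact hn (by simp)
  haveI : Fact (2 : ℕ).Prime := ⟨Nat.prime_two⟩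
  rw [padicValNat.mul hm hm]
  exact ⟨_, rfl⟩

/-- **PARITY LAW P1, typed** (`@[conjecture]`, nothing asserted): in the data of
`CMRankOneHeegnerIndexAtTwo` (CM `E` of analytic rank one, Heegner field `K′` with rank-zero twin,
Heegner point `P`, minimal twist model `Wd`, halvability value `k`), the `2`-adic valuation of the
`L`-free index quotient `𝔮` is EVEN. A consequence of `BSD(E,2)` + Cassels–Tate
(`even_padicValRat_cmHeegnerIndexQuotient_of_bsdp`); equivalently (unwinding `𝔮` at the primes of `K′`)
Kramer's parity theorem for `E/K′` plus a `2`-adic lemma on `u` — PROVABLE from print, not yet in the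
tree (Kramer 1981 Props 4–5 missing). Pre-registered and verified 86/86 (j236394).
[cite: Kramer1981, Thm. 1 and Props. 3, 6] [cite: Miller2011LMS, Def. 1.1] -/
@[conjecture] def CMRankOneHeegnerIndexParityAtTwo : Prop :=
  ∀ (W : WeierstrassCurve ℚ) [W.IsElliptic] [W.IsGloballyMinimal]
    (N : ℕ) [NeZero N] (K : Type) [Field K] [NumberField K]
    (Dt : ModularParametrizationData W N) (H : HeegnerDatum N (NumberField.discr K)) (ι : K →+* ℂ)
    (P : (W.baseChange K).toAffine.Point)
    (Wd : WeierstrassCurve ℚ) [Wd.IsElliptic] [Wd.IsGloballyMinimal] (Cd : VariableChange ℚ) (k : ℕ),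
    W.HasCM → W.analyticRank = 1 → IsImaginaryQuadratic K → SatisfiesHeegnerHypothesis N K →
    WeierstrassCurve.Affine.Point.map ι.toRatAlgHom P = heegnerPointComplex Dt H →
    (W.quadraticTwist (NumberField.discr K : ℚ)).entireLFunction 1 ≠ 0 →
    Cd • W.quadraticTwist (NumberField.discr K : ℚ) = Wd →
    (k = 1 ∨ k = 2) →
    (k = 2 ↔ ∀ y : W.toAffine.Point, ∃ Q : (W.baseChange K).toAffine.Point,
        QuadraticDescent.incl K W y - (2 : ℤ) • Q ∈
          AddCommGroup.torsion (W.baseChange K).toAffine.Point) →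
    Even (padicValRat 2 (cmHeegnerIndexQuotient W K P Dt.c k Wd Cd.u))

/-- **Per pair: `BSD(E,2)` forces `ord₂ 𝔮` to be EVEN** (the pre-registered law P1 on a pair where the
`2`-part is known). In the setting of `bsdp_two_iff_cmHeegnerIndex`, for the `k` of the halvability bit:
`BSDp W 2 → Even (ord₂ 𝔮)`, because `ord₂ 𝔮 = ord₂ #Ш(E)` and `#Ш(E)` is a square (Cassels–Tate, `hCT`).
[cite: MilneADT2006, Thm. I.6.13 (Cassels–Tate)] [cite: Miller2011LMS, Def. 1.1] -/
theorem even_padicValRat_cmHeegnerIndexQuotient_of_bsdp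
    (hCT : exists_casselsTate_pairing (K := ℚ))
    (W : WeierstrassCurve ℚ) [W.IsElliptic] [W.IsGloballyMinimal]
    (N : ℕ) [NeZero N] (K : Type) [Field K] [NumberField K]
    (Dt : ModularParametrizationData W N) (H : HeegnerDatum N (NumberField.discr K)) (ι : K →+* ℂ)
    (P : (W.baseChange K).toAffine.Point)
    (hGZ : gross_zagier N W K) (hKo : kolyvagin N W K)
    (hGZK : rank_eq_analyticRank_of_analyticRank_le_one) (hmod : hasEntireLFunction_rat)
    (hBF : bsdTriple_of_hasCM_of_L_one_ne_zero)
    (hcm : W.HasCM) (hK : IsImaginaryQuadratic K) (hHN : SatisfiesHeegnerHypothesis N K)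
    (hP : WeierstrassCurve.Affine.Point.map ι.toRatAlgHom P = heegnerPointComplex Dt H)
    (hr : W.analyticRank = 1)
    (hLt : (W.quadraticTwist (NumberField.discr K : ℚ)).entireLFunction 1 ≠ 0)
    (Wd : WeierstrassCurve ℚ) [Wd.IsElliptic] [Wd.IsGloballyMinimal] (Cd : VariableChange ℚ)
    (hWd : Cd • W.quadraticTwist (NumberField.discr K : ℚ) = Wd) :
    ∃ k : ℕ, (k = 1 ∨ k = 2) ∧
      (k = 2 ↔ ∀ y : W.toAffine.Point, ∃ Q : (W.baseChange K).toAffine.Point,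
        QuadraticDescent.incl K W y - (2 : ℤ) • Q ∈
          AddCommGroup.torsion (W.baseChange K).toAffine.Point) ∧
      (BSDp W 2 → Even (padicValRat 2 (cmHeegnerIndexQuotient W K P Dt.c k Wd Cd.u))) := by
  obtain ⟨hfin, -, -, -⟩ := shaAn_eq_cmHeegnerIndexFormula_two W N K Dt H ι P hGZ hKo hGZK hmod hBF
    hcm hK hHN hP hr hLt Wd Cd hWd
  haveI := hfin
  obtain ⟨k, hk12, hkiff, hiff⟩ := bsdp_two_iff_cmHeegnerIndex W N K Dt H ι P hGZ hKo hGZK hmod hBF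
    hcm hK hHN hP hr hLt Wd Cd hWd
  refine ⟨k, hk12, hkiff, fun hbsd => ?_⟩
  rw [hiff.mp hbsd]
  have hsq : IsSquare (Nat.card W.sha) := isSquare_card_sha_of_finite_of_casselsTate hCT W
  have hne : Nat.card W.sha ≠ 0 := (Nat.card_pos (α := W.sha)).ne'
  obtain ⟨m, hm⟩ := even_padicValNat_two_of_isSquare hne hsq
  exact ⟨(m : ℤ), by exact_mod_cast hm⟩

/-- **Class-wide: the typed O12 input implies the parity law P1** (granted Cassels–Tate and the named
facts that make `Ш(E)` finite in the setting: Gross–Zagier, Kolyvagin, GZK, modularity, Burungale–Flach).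
So P1 is a NECESSARY condition for `CMRankOneHeegnerIndexAtTwo` — the one the seat pre-registered and
checked (86/86). [cite: MilneADT2006, Thm. I.6.13 (Cassels–Tate)] [cite: Kramer1981, Thm. 1] -/
theorem cmRankOneHeegnerIndexParityAtTwo_of_input
    (hCT : exists_casselsTate_pairing (K := ℚ))
    (hGZ : ∀ (N : ℕ) [NeZero N] (W : WeierstrassCurve ℚ) (K : Type) [Field K] [NumberField K],
      gross_zagier N W K)
    (hKo : ∀ (N : ℕ) [NeZero N] (W : WeierstrassCurve ℚ) (K : Type) [Field K] [NumberField K],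
      kolyvagin N W K)
    (hGZK : rank_eq_analyticRank_of_analyticRank_le_one) (hmod : hasEntireLFunction_rat)
    (hBF : bsdTriple_of_hasCM_of_L_one_ne_zero)
    (hX : CMRankOneHeegnerIndexAtTwo) : CMRankOneHeegnerIndexParityAtTwo := by
  intro W _ _ N _ K _ _ Dt H ι P Wd _ _ Cd k hcm hr hKq hHN hP hLt hWd hk12 hkiff
  obtain ⟨hfin, -, -, -⟩ := shaAn_eq_cmHeegnerIndexFormula_two W N K Dt H ι P (hGZ N W K) (hKo N W K)
    hGZK hmod hBF hcm hKq hHN hP hr hLt Wd Cd hWd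
  haveI := hfin
  rw [hX W N K Dt H ι P Wd Cd k hcm hr hKq hHN hP hLt hWd hk12 hkiff]
  have hsq : IsSquare (Nat.card W.sha) := isSquare_card_sha_of_finite_of_casselsTate hCT W
  have hne : Nat.card W.sha ≠ 0 := (Nat.card_pos (α := W.sha)).ne'
  obtain ⟨m, hm⟩ := even_padicValNat_two_of_isSquare hne hsq
  exact ⟨(m : ℤ), by exact_mod_cast hm⟩

/-! ## §2 The `L`-free index quotient does not depend on the auxiliary datum (unconditional) -/

/-- **INDEPENDENCE OF THE AUXILIARY DATUM (a theorem, not a target).** For a CM curve `E/ℚ` of analytic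
rank one and TWO admissible auxiliary data — Heegner fields `K₁, K₂` (levels `N₁, N₂`, parametrisation
data, Heegner points `P₁, P₂`, rank-zero twins with minimal models `Wd₁, Wd₂`) — the `L`-free index
quotients COINCIDE as rational numbers (for the respective halvability values): both equal `#Ш_an(E)`
(`shaAn_eq_cmHeegnerIndexFormula_two`). Unwound: `I₁²·#E^{D₁}(ℚ)²/(k₁² t_{K₁}² c₁² w₁² #Ш(E^{D₁}) c(E^{D₁}) |u₁|)
= I₂²·#E^{D₂}(ℚ)²/(k₂² t_{K₂}² c₂² w₂² #Ш(E^{D₂}) c(E^{D₂}) |u₂|)` — a relation between the divisibility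
indices of Heegner points over DIFFERENT fields and the Tate–Shafarevich groups of DIFFERENT rank-zero CM
twists, with no `L`-value left (Gross–Zagier for both fields + Burungale–Flach for both twins). Granted the
named facts only; nothing conjectural enters. [cite: GrossZagier1986, Thm. I.6.3 and V.§2]
[cite: BurungaleFlach2024, Thm. 1.1 and Cor. 2] -/
theorem cmHeegnerIndexQuotient_eq_of_two_data
    (W : WeierstrassCurve ℚ) [W.IsElliptic] [W.IsGloballyMinimal]
    (hGZK : rank_eq_analyticRank_of_analyticRank_le_one) (hmod : hasEntireLFunction_rat)
    (hBF : bsdTriple_of_hasCM_of_L_one_ne_zero) (hcm : W.HasCM) (hr : W.analyticRank = 1)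
    -- first datum
    (N₁ : ℕ) [NeZero N₁] (K₁ : Type) [Field K₁] [NumberField K₁]
    (Dt₁ : ModularParametrizationData W N₁) (H₁ : HeegnerDatum N₁ (NumberField.discr K₁)) (ι₁ : K₁ →+* ℂ)
    (P₁ : (W.baseChange K₁).toAffine.Point) (hGZ₁ : gross_zagier N₁ W K₁) (hKo₁ : kolyvagin N₁ W K₁)
    (hK₁ : IsImaginaryQuadratic K₁) (hHN₁ : SatisfiesHeegnerHypothesis N₁ K₁)
    (hP₁ : WeierstrassCurve.Affine.Point.map ι₁.toRatAlgHom P₁ = heegnerPointComplex Dt₁ H₁)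
    (hLt₁ : (W.quadraticTwist (NumberField.discr K₁ : ℚ)).entireLFunction 1 ≠ 0)
    (Wd₁ : WeierstrassCurve ℚ) [Wd₁.IsElliptic] [Wd₁.IsGloballyMinimal] (Cd₁ : VariableChange ℚ)
    (hWd₁ : Cd₁ • W.quadraticTwist (NumberField.discr K₁ : ℚ) = Wd₁)
    -- second datum
    (N₂ : ℕ) [NeZero N₂] (K₂ : Type) [Field K₂] [NumberField K₂]
    (Dt₂ : ModularParametrizationData W N₂) (H₂ : HeegnerDatum N₂ (NumberField.discr K₂)) (ι₂ : K₂ →+* ℂ)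
    (P₂ : (W.baseChange K₂).toAffine.Point) (hGZ₂ : gross_zagier N₂ W K₂) (hKo₂ : kolyvagin N₂ W K₂)
    (hK₂ : IsImaginaryQuadratic K₂) (hHN₂ : SatisfiesHeegnerHypothesis N₂ K₂)
    (hP₂ : WeierstrassCurve.Affine.Point.map ι₂.toRatAlgHom P₂ = heegnerPointComplex Dt₂ H₂)
    (hLt₂ : (W.quadraticTwist (NumberField.discr K₂ : ℚ)).entireLFunction 1 ≠ 0)
    (Wd₂ : WeierstrassCurve ℚ) [Wd₂.IsElliptic] [Wd₂.IsGloballyMinimal] (Cd₂ : VariableChange ℚ)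
    (hWd₂ : Cd₂ • W.quadraticTwist (NumberField.discr K₂ : ℚ) = Wd₂) :
    ∃ k₁ k₂ : ℕ, (k₁ = 1 ∨ k₁ = 2) ∧ (k₂ = 1 ∨ k₂ = 2) ∧
      (k₁ = 2 ↔ ∀ y : W.toAffine.Point, ∃ Q : (W.baseChange K₁).toAffine.Point,
        QuadraticDescent.incl K₁ W y - (2 : ℤ) • Q ∈
          AddCommGroup.torsion (W.baseChange K₁).toAffine.Point) ∧
      (k₂ = 2 ↔ ∀ y : W.toAffine.Point, ∃ Q : (W.baseChange K₂).toAffine.Point,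
        QuadraticDescent.incl K₂ W y - (2 : ℤ) • Q ∈
          AddCommGroup.torsion (W.baseChange K₂).toAffine.Point) ∧
      cmHeegnerIndexQuotient W K₁ P₁ Dt₁.c k₁ Wd₁ Cd₁.u =
        cmHeegnerIndexQuotient W K₂ P₂ Dt₂.c k₂ Wd₂ Cd₂.u := by
  obtain ⟨-, -, -, k₁, hk₁, hk₁iff, h₁⟩ := shaAn_eq_cmHeegnerIndexFormula_two W N₁ K₁ Dt₁ H₁ ι₁ P₁
    hGZ₁ hKo₁ hGZK hmod hBF hcm hK₁ hHN₁ hP₁ hr hLt₁ Wd₁ Cd₁ hWd₁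
  obtain ⟨-, -, -, k₂, hk₂, hk₂iff, h₂⟩ := shaAn_eq_cmHeegnerIndexFormula_two W N₂ K₂ Dt₂ H₂ ι₂ P₂
    hGZ₂ hKo₂ hGZK hmod hBF hcm hK₂ hHN₂ hP₂ hr hLt₂ Wd₂ Cd₂ hWd₂
  exact ⟨k₁, k₂, hk₁, hk₂, hk₁iff, hk₂iff, Rat.cast_injective (α := ℂ) (h₁.symm.trans h₂)⟩

end Summit.BirchSwinnertonDyer.Rank1Residual.P2

end
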